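import Mathlib
import HarnessLib
import Summits.HubbardSuperconductivity.HubbardSuperconductivity.Theorems.KLProgrammeKLRegimeEngineV8DefsG5
import Summits.HubbardSuperconductivity.HubbardSuperconductivity.Theorems.KLProgrammeKLRegimeSplitEngineV10

/-!
# K3 engine package `klEngGeo5` (GAINS RIDER) on the GEN-6 engine slot `EngineBoundsAtV10S`: the `scaleGains` transfer of every V10 conjunct and the
# package transfers `klEngGeo3 / klEngGeo4 ⟶ klEngGeo5` at V10S
# (cell gate-hubbard-kl, seat hubbard-kl-k3c2-p2 g6; companion of `…EngineV8DefsG5` §1/§2 for the (R-Dq) slot of `…SplitEngineV10`, plan g14 (R12) T2)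

The V10 value clauses differ from their V9/V6/S3/S2 sources by the token `legDressBarQ ↦ legDressBarQ2` only; `legDressBarQ2` does not read `G`,
so the covariant `scaleGains` transfer of `…EngineV8DefsG5` §1 ports verbatim:

* §1 `legDressBarQ2_scaleGains` (`rfl`), `quarticValueUVAtS3_scaleGains_iff`, `pairLadderStepAtV10_scaleGains_of`, `pairValueIncrementAtV7_scaleGains_of`,
  `quarticValueIncrementAtS4_scaleGains_of`, **`engineBoundsAtV10S_scaleGains_of`** (`G.WF`, `1 ≤ κ`, `0 ≤ P.Klam`);
* §2 **`engineBoundsAtV10S_klEngGeo5_of_klEngGeo4`**, `engineBoundsAtV10S_klEngGeo5_of_klEngGeo3` (`0 ≤ P.Klam`), and the mixed door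
  `engineBoundsAtV10S_klEngGeo5_of_V9S_klEngGeo4` (a V9S producer at `klEngGeo4` lands in the gen-6 slot at `klEngGeo5`; `P.WF`, `Q.WF`).

Order-preserving inequalities over the route's predicates; nothing about the model is asserted.
-/

noncomputable section

namespace Summit.HubbardSuperconductivity.HubbardSuperconductivity.Theorems.KLRegimeSplit

set_option linter.dupNamespace false -- summit = problem name (single-conjunct summit), D-0017

open Real Finset Literature.MathematicalPhysics.QuantumLattice Literature.Probability.LatticeModels
open Summit.HubbardSuperconductivity.HubbardSuperconductivity.Theorems.KLProgrammeLegKernels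

/-! ## §1 The V10 conjuncts under `scaleGains` -/

/-- `legDressBarQ2` does not read `G`. -/
theorem legDressBarQ2_scaleGains (G : GeoConsts) (κ : ℝ) (P : SplitConsts) (Q : EngConsts) (U : ℝ) (n c : ℕ) :
    legDressBarQ2 (G.scaleGains κ) P Q U n c = legDressBarQ2 G P Q U n c := rfl

section Model

variable {L M : ℕ} [NeZero L] [NeZero M] {G : GeoConsts} {κ : ℝ} {P : SplitConsts} {Q : EngConsts} {β U μ : ℝ} {K : TrigPolyC4v}
  {n : ℕ}

/-- **(E2′-S3 UV) is unchanged by `scaleGains`.** -/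
theorem quarticValueUVAtS3_scaleGains_iff (κ : ℝ) :
    QuarticValueUVAtS3 L M (G.scaleGains κ) P Q β U μ K n ↔ QuarticValueUVAtS3 L M G P Q β U μ K n := by
  simp only [QuarticValueUVAtS3, initDevBar_scaleGains, legDressBarQ2_scaleGains]

/-- **(E2-v10) transfers to `scaleGains`** (`G.WF`, `1 ≤ κ`): the scale-`0` clause is unchanged; the step clause's budget grows through `thermalBar`
and the (X) line `(Klam U)²·(phGain + phGain)`. -/
theorem pairLadderStepAtV10_scaleGains_of (hG : G.WF) (hκ : 1 ≤ κ) (h : PairLadderStepAtV10 L M G P Q β U μ K n) :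
    PairLadderStepAtV10 L M (G.scaleGains κ) P Q β U μ K n := by
  have hph : ∀ m ρ, 0 ≤ G.phGain m ρ := hG.2.2.2.2.2.2.2.2.2.2.2.2.1
  have hCF : 0 ≤ G.CF := hG.2.2.2.2.2.2.2.2.2.2.2.2.2.1
  obtain ⟨h0, hs⟩ := h
  refine ⟨fun hn Qm k hk k' hk' => ?_, fun hn Qm hQm => ?_⟩
  · rw [initDevBar_scaleGains, legDressBarQ2_scaleGains]
    exact h0 hn Qm k hk k' hk'
  · obtain ⟨w, hw1, hw2, N, hN, hb⟩ := hs hn Qm hQm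
    refine ⟨w, hw1, ?_, N, hN, fun k hk k' hk' => (hb k hk k' hk').trans ?_⟩
    · rw [klEdge_scaleGains]; exact hw2
    · rw [drivePBar_scaleGains, eremBar_scaleGains, legDressBarQ2_scaleGains]
      have hth := thermalBar_le_scaleGains (P := P) hCF hκ U β n
      have h1 := GeoConsts.phGain_le_scaleGains hph hκ n (klTorusNorm L (k - k'))
      have h2 := GeoConsts.phGain_le_scaleGains hph hκ n (klTorusNorm L (k + k' - Qm))
      have hsq : 0 ≤ (P.Klam * U) ^ 2 := sq_nonneg _
      nlinarith

/-- **(E2″-v7) transfers to `scaleGains`** (`gainBar`, `thermalBar` grow; `eremBar`, `legDressBarQ2` unchanged). -/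
theorem pairValueIncrementAtV7_scaleGains_of (hG : G.WF) (hκ : 1 ≤ κ) (h : PairValueIncrementAtV7 L M G P Q β U μ K n) :
    PairValueIncrementAtV7 L M (G.scaleGains κ) P Q β U μ K n := by
  have hpp : ∀ m ρ, 0 ≤ G.ppGain m ρ := hG.2.2.2.2.2.2.2.2.2.2.2.1
  have hph : ∀ m ρ, 0 ≤ G.phGain m ρ := hG.2.2.2.2.2.2.2.2.2.2.2.2.1
  have hCF : 0 ≤ G.CF := hG.2.2.2.2.2.2.2.2.2.2.2.2.2.1
  intro hn Qm k hk k' hk'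
  refine (h hn Qm k hk k' hk').trans ?_
  rw [eremBar_scaleGains, legDressBarQ2_scaleGains]
  have h1 := gainBar_le_scaleGains (P := P) hpp hph hκ U n (klTorusNorm L Qm) (klTorusNorm L (k - k')) (klTorusNorm L (k + k' - Qm))
  have h2 := thermalBar_le_scaleGains (P := P) hCF hκ U β n
  linarith

/-- **(E2′-S4) transfers to `scaleGains`.** -/
theorem quarticValueIncrementAtS4_scaleGains_of (hG : G.WF) (hκ : 1 ≤ κ) (h : QuarticValueIncrementAtS4 L M G P Q β U μ K n) :
    QuarticValueIncrementAtS4 L M (G.scaleGains κ) P Q β U μ K n := by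
  have hpp : ∀ m ρ, 0 ≤ G.ppGain m ρ := hG.2.2.2.2.2.2.2.2.2.2.2.1
  have hph : ∀ m ρ, 0 ≤ G.phGain m ρ := hG.2.2.2.2.2.2.2.2.2.2.2.2.1
  have hCF : 0 ≤ G.CF := hG.2.2.2.2.2.2.2.2.2.2.2.2.2.1
  intro hn k₁ hk₁ k₂ hk₂ k₃ hk₃
  refine (h hn k₁ hk₁ k₂ hk₂ k₃ hk₃).trans ?_
  rw [eremBar_scaleGains, legDressBarQ2_scaleGains]
  have h1 := gainBar_le_scaleGains (P := P) hpp hph hκ U n (klTorusNorm L (k₁ + k₃)) (klTorusNorm L (k₁ - k₂)) (klTorusNorm L (k₂ - k₃))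
  have h2 := thermalBar_le_scaleGains (P := P) hCF hκ U β n
  linarith

/-- **The whole V10 engine slot transfers to `scaleGains`**: `EngineBoundsAtV10S … G … n → EngineBoundsAtV10S … (G.scaleGains κ) … n`
(`G.WF`, `1 ≤ κ`, `0 ≤ P.Klam`; (E0) and (E1-v4) do not read `G`). -/
theorem engineBoundsAtV10S_scaleGains_of (hG : G.WF) (hκ : 1 ≤ κ) (hK : 0 ≤ P.Klam) (h : EngineBoundsAtV10S L M G P Q β U μ K n) :
    EngineBoundsAtV10S L M (G.scaleGains κ) P Q β U μ K n := by
  have hCF : 0 ≤ G.CF := hG.2.2.2.2.2.2.2.2.2.2.2.2.2.1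
  obtain ⟨h0, h1, h2, h3, h4, h5, h6, h7⟩ := h
  exact ⟨h0, h1, pairLadderStepAtV10_scaleGains_of hG hκ h2, pairValueIncrementAtV7_scaleGains_of hG hκ h3,
    quarticValueIncrementAtS4_scaleGains_of hG hκ h4, (quarticValueUVAtS3_scaleGains_iff κ).2 h5,
    engineFirstMoments_scaleGains_of κ hK h6, isoTupleL1AtS_scaleGains_of hCF hκ h7⟩

end Model

end Summit.HubbardSuperconductivity.HubbardSuperconductivity.Theorems.KLRegimeSplit

/-! ## §2 The package transfers at V10S -/

namespace Summit.HubbardSuperconductivity.HubbardSuperconductivity.Theorems.EngineV8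

set_option linter.dupNamespace false -- summit = problem name (single-conjunct summit), D-0017

open Real Finset Literature.MathematicalPhysics.QuantumLattice Literature.Probability.LatticeModels
open Summit.HubbardSuperconductivity.HubbardSuperconductivity.Theorems.KLRegimeSplit

variable {L M : ℕ} [NeZero L] [NeZero M] {P : SplitConsts} {Q : EngConsts} {β U μ : ℝ} {K : TrigPolyC4v} {n : ℕ}

/-- **The V10 engine slot transfers from `klEngGeo4` to `klEngGeo5`** (`0 ≤ P.Klam`). -/
theorem engineBoundsAtV10S_klEngGeo5_of_klEngGeo4 (hK : 0 ≤ P.Klam) (h : EngineBoundsAtV10S L M klEngGeo4 P Q β U μ K n) :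
    EngineBoundsAtV10S L M klEngGeo5 P Q β U μ K n :=
  engineBoundsAtV10S_scaleGains_of klEngGeo4_wf (by norm_num) hK h

/-- **… and from `klEngGeo3`** (`klEngGeo4 = klEngGeo3.raise …`: first V9S-style raise at V10S, then the gains rider). -/
theorem engineBoundsAtV10S_klEngGeo5_of_klEngGeo3 (hP : P.WF) (hQ : Q.WF) (h : EngineBoundsAtV9S L M klEngGeo3 P Q β U μ K n) :
    EngineBoundsAtV10S L M klEngGeo5 P Q β U μ K n :=
  engineBoundsAtV10S_klEngGeo5_of_klEngGeo4 (zero_le_one.trans hP.1)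
    (engineBoundsAtV10S_of_V9S hP hQ (engineBoundsAtV9S_klEngGeo4_of_klEngGeo3 (zero_le_one.trans hP.1) h))

/-- **Mixed door**: a V9S producer at `klEngGeo4` lands in the gen-6 slot `EngineBoundsAtV10S … klEngGeo5 …` (`P.WF`, `Q.WF`). -/
theorem engineBoundsAtV10S_klEngGeo5_of_V9S_klEngGeo4 (hP : P.WF) (hQ : Q.WF) (h : EngineBoundsAtV9S L M klEngGeo4 P Q β U μ K n) :
    EngineBoundsAtV10S L M klEngGeo5 P Q β U μ K n :=
  engineBoundsAtV10S_of_V9S hP hQ (engineBoundsAtV9S_klEngGeo5_of_klEngGeo4 (zero_le_one.trans hP.1) h)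

/-- `PairValueIncrementAtV7` transfers from `klEngGeo4` to `klEngGeo5`. -/
theorem pairValueIncrementAtV7_klEngGeo5_of_klEngGeo4 (h : PairValueIncrementAtV7 L M klEngGeo4 P Q β U μ K n) :
    PairValueIncrementAtV7 L M klEngGeo5 P Q β U μ K n :=
  pairValueIncrementAtV7_scaleGains_of klEngGeo4_wf (by norm_num) h

/-- `PairLadderStepAtV10` transfers from `klEngGeo4` to `klEngGeo5`. -/
theorem pairLadderStepAtV10_klEngGeo5_of_klEngGeo4 (h : PairLadderStepAtV10 L M klEngGeo4 P Q β U μ K n) :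
    PairLadderStepAtV10 L M klEngGeo5 P Q β U μ K n :=
  pairLadderStepAtV10_scaleGains_of klEngGeo4_wf (by norm_num) h

end Summit.HubbardSuperconductivity.HubbardSuperconductivity.Theorems.EngineV8

end
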